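import Literature.MathematicalPhysics.QuantumLattice.HubbardNNNHoppingFluxGaugeFunction
import Literature.MathematicalPhysics.QuantumLattice.HubbardNNNHoppingFluxThermal
import HarnessLib

/-!
# The gauge-function bound on the flux response of the `t–t'` torus at positive temperature

Topic `Literature/MathematicalPhysics/QuantumLattice` (family `hubbard`). Everything here is
PROVED (no named fact). The positive-temperature companion of
`HubbardNNNHoppingFluxGaugeFunction.lean` (`fluxEnergyTT'_sub_le_oneSubCos_trialGauge`, `T = 0`)
and the gauge-function refinement of the thermal f-sum bound
`log_partitionFn_toBlock_hubbardTorusTT'Flux_ge` (`HubbardNNNHoppingFluxThermal.lean`; `φ = 0`).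

Content. Paramekanti–Trivedi–Randeria, PRB 57 (1998) 11639, §IV "Generalization to finite
temperatures", eq. (trial-rho): the trial density matrix `exp[iΣ_r n̂_r θ(r)] ρ̂₀ exp[−iΣ_r n̂_r θ(r)]`
has the entropy of `ρ̂₀`, and its energy is the `T = 0` expression, eq. (heat), with THERMAL
expectation values of the local kinetic energies; minimising over the gauge function
`θ(r) = (Φ/L)(r₁ + φ(r))` is the resistor-network problem of eqs. (kirchoff)–(leg-bd). Here, for
the two-dimensional `t–t'` Hubbard torus `hubbardTorusTT'Flux L t' U θ` (seam flux `θ`) and EVERY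
coordinate sector `p` (`Z_β(M|_p) = Matrix.partitionFn β (M.toBlock p p)`, `⟨A⟩_{β,p}` the Gibbs
state of the untwisted block `H^{tt'}|_p`), with the trial-gauge bond phases
`u_{x,i} = (θ/L)(δ_{i,0} + φ(x+eᵢ) − φ(x))`, `u^d_{s,x} = (θ/L)(1 + φ(x+j_s) − φ(x))` and the
symmetrised bond operators `B_{x,i,σ} = c†_{x+eᵢ,σ} c_{x,σ} + h.c.`, `B^d_{s,x,σ} = c†_{x+j_s,σ} c_{x,σ} + h.c.`:
* `log_partitionFn_toBlock_hubbardTorusTT'Flux_ge_trialGauge` — **the flux costs at most the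
  gauge-function bond sum**, for EVERY `φ : (ℤ/L)² → ℝ`:
  `log Z_β(H^{tt'}|_p) − β [Σ_{x,i,σ} (1 − cos u_{x,i}) Re⟨B_{x,i,σ}⟩_{β,p}
   + t' Σ_{s,x,σ} (1 − cos u^d_{s,x}) Re⟨B^d_{s,x,σ}⟩_{β,p}] ≤ log Z_β(H^{tt'}(θ)|_p)`,
  i.e. for `β > 0`, `F_p(θ) − F_p(0) ≤ Σ_b t_b (1 − cos u_b) Re⟨B_b⟩_{β,p}` (exact `1 − cos` form).
Proof — Peierls–Bogoliubov instead of the variational principle for density matrices: conjugate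
`H^{tt'}(±θ)` by the trial gauge `W_φ(±θ)` (`conj_hubbardTorusTT'Flux_eq_gaugeTransform`; the sector
partition functions are invariant, `partitionFn_toBlock_conj_hubbardTorusTT'Flux`), apply
`log_partitionFn_sub_le_log_partitionFn_add` at the untwisted block for `+θ` and `−θ`, use time
reversal `Re Z(H(−θ)|_p) = Re Z(H(θ)|_p)`, and the midpoint identity
`W_φ(θ)ᴴ H(θ) W_φ(θ) + W_φ(−θ)ᴴ H(−θ) W_φ(−θ) − 2 H^{tt'} = Σ_b 2 t_b (1 − cos u_b) B_b` (the bond currents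
cancel between `±θ`), proved as the vanishing of a Hermitian quadratic form
(`re_star_dotProduct_conj_trialGauge_mulVec`) and transported into the Gibbs state by positivity.

Not here: the `θ → 0` limit (the stiffness ceiling with the quadratic weights, PTR98 eq. (var-bd) at
`T > 0`) — a cell-side statement; the sides `L = 1, 2`.

## References

* A. Paramekanti, N. Trivedi, M. Randeria, *Upper bounds on the superfluid stiffness of
  disordered systems*, Phys. Rev. B 57 (1998) 11639 (arXiv:cond-mat/9801053), §IV eqs. (trial),
  (heat), (var-bd) and "Generalization to finite temperatures", eq. (trial-rho). [ParamekantiTrivediRanderia1998]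
* T. Hazra, N. Verma, M. Randeria, Phys. Rev. X 9 (2019) 031049, eq. (2), App. C. [HazraVermaRanderia2019]
* H. Watanabe, J. Stat. Phys. 177 (2019) 717, §2.2.1–§2.2.3. [Watanabe2019]
* N. Byers, C. N. Yang, Phys. Rev. Lett. 7 (1961) 46. [ByersYang1961]
-/

noncomputable section

namespace Literature.MathematicalPhysics.QuantumLattice

open Matrix Finset Literature.MathematicalPhysics.QuantumFieldTheory

open scoped ComplexConjugate ComplexOrder

variable {L : ℕ} [NeZero L]

/-! ### Conjugating by a site-phase gauge: hermiticity and sector partition functions -/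

/-- `W_gᴴ H^{tt'}(θ) W_g` is Hermitian for every site-phase gauge `g`. [folklore] -/
private theorem isHermitian_conj_hubbardTorusTT'Flux (g : FermionTorus 2 L → Circle) (t' U θ : ℝ) :
    ((phaseGauge g)ᴴ * hubbardTorusTT'Flux L t' U θ * phaseGauge g).IsHermitian :=
  Matrix.isHermitian_conjTranspose_mul_mul _ (isHermitian_hubbardTorusTT'Flux L t' U θ)

/-- **Gauge invariance of the sector partition functions, arbitrary gauge**: for every site-phase
gauge `g` the conjugated operator `W_gᴴ H^{tt'}(θ) W_g` and `H^{tt'}(θ)` have the same partition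
function on every coordinate sector `p` (`W_g` is diagonal in the occupation basis and commutes with
the compression) — the unitary invariance of the entropy term of the trial density matrix, PTR98
§IV eq. (trial-rho). [cite: ParamekantiTrivediRanderia1998, §IV eq. (trial-rho)] -/
theorem partitionFn_toBlock_conj_hubbardTorusTT'Flux (g : FermionTorus 2 L → Circle)
    (t' U θ β : ℝ) (p : Finset (Orb (FermionTorus 2 L)) → Prop) [Fintype {a // p a}]
    [DecidableEq {a // p a}] :
    partitionFn β (((phaseGauge g)ᴴ * hubbardTorusTT'Flux L t' U θ * phaseGauge g).toBlock p p) =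
      partitionFn β ((hubbardTorusTT'Flux L t' U θ).toBlock p p) := by
  have hunit : ∀ z : Circle, star (z : ℂ) * (z : ℂ) = 1 := fun z => by
    rw [Complex.star_def, ← Complex.normSq_eq_conj_mul_self, Circle.normSq_coe, Complex.ofReal_one]
  rw [phaseGauge_eq, conjTranspose_diagonal_inst, toBlock_diagonal_mul_mul_diagonal]
  exact partitionFn_diagonal_star_mul_mul_diagonal _ (fun a => hunit _) β _

/-! ### The PTR trial gauge at `±θ` in a fixed vector -/

/-- **The PTR trial gauge in a fixed vector** (`L ≥ 3`): for `W_φ = phaseGauge (x ↦ e^{-i(θ/L)(x₁ + φ(x))})`,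
`Re⟨v, W_φᴴ H^{tt'}(θ) W_φ v⟩ = Re⟨v, H^{tt'} v⟩ + Σ_{x,i,σ} [2(1 − cos u_{x,i}) Re h + 2 sin u_{x,i} Im h]
 + t' Σ_{s,x,σ} [2(1 − cos u^d_{s,x}) Re h^d + 2 sin u^d_{s,x} Im h^d]`, `h = ⟨v, c†_{x+eᵢ,σ} c_{x,σ} v⟩`,
`h^d = ⟨v, c†_{x+j_s,σ} c_{x,σ} v⟩` (PTR98 §IV eq. (heat) for an arbitrary vector, before dropping the
currents and before expanding the cosine). [cite: ParamekantiTrivediRanderia1998, §IV eqs. (trial)–(heat)] -/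
theorem re_star_dotProduct_conj_trialGauge_mulVec (hL : 3 ≤ L) (t' U θ : ℝ) (φ : Site 2 L → ℝ)
    (v : Fock (Orb (FermionTorus 2 L))) :
    (star v ⬝ᵥ (((phaseGauge fun u : FermionTorus 2 L =>
            twistGauge L θ u.toTorusSite * Circle.exp (-(θ / L * φ u.toTorusSite)))ᴴ *
          hubbardTorusTT'Flux L t' U θ *
          phaseGauge (fun u : FermionTorus 2 L =>
            twistGauge L θ u.toTorusSite * Circle.exp (-(θ / L * φ u.toTorusSite)))) *ᵥ v)).re =
      (star v ⬝ᵥ (hubbardTorusTT' L 1 t' U *ᵥ v)).re +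
        (∑ x : Site 2 L, ∑ i : Fin 2, ∑ σ : Fin 2,
          (2 * (1 - Real.cos (θ / L * ((![1, 0] : Fin 2 → ℝ) i + φ (x.shift i) - φ x))) *
              (star v ⬝ᵥ ((creation (orb (FermionTorus.ofTorusSite (Site.shift x i)) σ) *
                annihilation (orb (FermionTorus.ofTorusSite x) σ)) *ᵥ v)).re +
            2 * Real.sin (θ / L * ((![1, 0] : Fin 2 → ℝ) i + φ (x.shift i) - φ x)) *
              (star v ⬝ᵥ ((creation (orb (FermionTorus.ofTorusSite (Site.shift x i)) σ) *
                annihilation (orb (FermionTorus.ofTorusSite x) σ)) *ᵥ v)).im)) +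
        t' * ∑ s : Fin 2, ∑ x : Site 2 L, ∑ σ : Fin 2,
          (2 * (1 - Real.cos (θ / L * (1 + φ (x + torusDiagJump L s) - φ x))) *
              (star v ⬝ᵥ ((creation (orb (FermionTorus.ofTorusSite (x + torusDiagJump L s)) σ) *
                annihilation (orb (FermionTorus.ofTorusSite x) σ)) *ᵥ v)).re +
            2 * Real.sin (θ / L * (1 + φ (x + torusDiagJump L s) - φ x)) *
              (star v ⬝ᵥ ((creation (orb (FermionTorus.ofTorusSite (x + torusDiagJump L s)) σ) *
                annihilation (orb (FermionTorus.ofTorusSite x) σ)) *ᵥ v)).im) := by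
  rw [conj_hubbardTorusTT'Flux_eq_gaugeTransform hL
      (fun y : Site 2 L => twistGauge L θ y * Circle.exp (-(θ / L * φ y))),
    re_star_dotProduct_peierlsTT'_mulVec hL]
  simp only [coe_gaugeTransform_trialGauge_seamFluxConfig (show 2 ≤ L by omega),
    trialGauge_diag_amplitude (show 2 ≤ L by omega), Complex.exp_ofReal_mul_I_re,
    Complex.exp_ofReal_mul_I_im]


/-! ### The midpoint defect: bookkeeping -/

omit [NeZero L] in
/-- The `±θ` bookkeeping: `Σ (cR + I) + Σ (cR + (−I)) = Σ c (2R)` over a triple index. [folklore] -/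
private theorem sum3_add_sum3_neg {α β γ : Type*} [Fintype α] [Fintype β] [Fintype γ]
    (c R I : α → β → γ → ℝ) :
    (∑ a : α, ∑ b : β, ∑ k : γ, (c a b k * R a b k + I a b k)) +
        (∑ a : α, ∑ b : β, ∑ k : γ, (c a b k * R a b k + -I a b k)) =
      ∑ a : α, ∑ b : β, ∑ k : γ, c a b k * (2 * R a b k) := by
  rw [← Finset.sum_add_distrib]
  refine Finset.sum_congr rfl fun a _ => ?_
  rw [← Finset.sum_add_distrib]
  refine Finset.sum_congr rfl fun b _ => ?_
  rw [← Finset.sum_add_distrib]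
  refine Finset.sum_congr rfl fun k _ => ?_
  ring

omit [NeZero L] in
/-- A triple sum of Hermitian matrices is Hermitian. [folklore] -/
private theorem isHermitian_sum₃ {α β γ : Type*} [Fintype α] [Fintype β] [Fintype γ] {n : Type*}
    (f : α → β → γ → Matrix n n ℂ) (h : ∀ a b k, (f a b k).IsHermitian) :
    (∑ a : α, ∑ b : β, ∑ k : γ, f a b k).IsHermitian := by
  have h' : ∀ a b k, (f a b k)ᴴ = f a b k := fun a b k => (h a b k).eq
  show (∑ a : α, ∑ b : β, ∑ k : γ, f a b k)ᴴ = _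
  simp only [conjTranspose_sum, h']

omit [NeZero L] in
/-- A symmetrised hop in expectation: `Re⟨v, (c†_q c_p + c†_p c_q) v⟩ = 2 Re⟨v, c†_q c_p v⟩`. [folklore] -/
private theorem re_star_dotProduct_symHop_mulVec (p q : FermionTorus 2 L × Fin 2)
    (v : Fock (Orb (FermionTorus 2 L))) :
    (star v ⬝ᵥ ((creation (toLex q) * annihilation (toLex p) +
        creation (toLex p) * annihilation (toLex q)) *ᵥ v)).re =
      2 * (star v ⬝ᵥ ((creation (toLex q) * annihilation (toLex p)) *ᵥ v)).re := by
  rw [add_mulVec, dotProduct_add, Complex.add_re,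
    star_dotProduct_creation_mul_annihilation_mulVec_swap (toLex q) (toLex p), Complex.conj_re, two_mul]

/-- The bond-weight operator `M_φ(θ) = Σ_{x,i,σ} 2(1 − cos u_{x,i}) B_{x,i,σ} + t' Σ_{s,x,σ} 2(1 − cos u^d_{s,x}) B^d_{s,x,σ}`
(`B = c†_{x+eᵢ,σ} c_{x,σ} + h.c.`) in a fixed vector:
`Re⟨v, M_φ(θ) v⟩ = Σ_{x,i,σ} 2(1 − cos u_{x,i}) (2 Re h) + t' Σ_{s,x,σ} 2(1 − cos u^d_{s,x}) (2 Re h^d)`. [folklore] -/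
private theorem re_star_dotProduct_bondWeightOp_mulVec (t' θ : ℝ) (φ : Site 2 L → ℝ)
    (v : Fock (Orb (FermionTorus 2 L))) :
    (star v ⬝ᵥ (((∑ x : Site 2 L, ∑ i : Fin 2, ∑ σ : Fin 2,
        ((2 * (1 - Real.cos (θ / L * ((![1, 0] : Fin 2 → ℝ) i + φ (x.shift i) - φ x))) : ℝ) : ℂ) •
          (creation (orb (FermionTorus.ofTorusSite (Site.shift x i)) σ) *
              annihilation (orb (FermionTorus.ofTorusSite x) σ) +
            creation (orb (FermionTorus.ofTorusSite x) σ) *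
              annihilation (orb (FermionTorus.ofTorusSite (Site.shift x i)) σ))) +
      ∑ s : Fin 2, ∑ x : Site 2 L, ∑ σ : Fin 2,
        ((t' * (2 * (1 - Real.cos (θ / L * (1 + φ (x + torusDiagJump L s) - φ x)))) : ℝ) : ℂ) •
          (creation (orb (FermionTorus.ofTorusSite (x + torusDiagJump L s)) σ) *
              annihilation (orb (FermionTorus.ofTorusSite x) σ) +
            creation (orb (FermionTorus.ofTorusSite x) σ) *
              annihilation (orb (FermionTorus.ofTorusSite (x + torusDiagJump L s)) σ))) *ᵥ v)).re =
      (∑ x : Site 2 L, ∑ i : Fin 2, ∑ σ : Fin 2,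
          2 * (1 - Real.cos (θ / L * ((![1, 0] : Fin 2 → ℝ) i + φ (x.shift i) - φ x))) *
            (2 * (star v ⬝ᵥ ((creation (orb (FermionTorus.ofTorusSite (Site.shift x i)) σ) *
                annihilation (orb (FermionTorus.ofTorusSite x) σ)) *ᵥ v)).re)) +
        t' * ∑ s : Fin 2, ∑ x : Site 2 L, ∑ σ : Fin 2,
          2 * (1 - Real.cos (θ / L * (1 + φ (x + torusDiagJump L s) - φ x))) *
            (2 * (star v ⬝ᵥ ((creation (orb (FermionTorus.ofTorusSite (x + torusDiagJump L s)) σ) *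
                annihilation (orb (FermionTorus.ofTorusSite x) σ)) *ᵥ v)).re) := by
  rw [add_mulVec, dotProduct_add, Complex.add_re]
  simp only [Matrix.sum_mulVec, smul_mulVec, dotProduct_sum, dotProduct_smul, smul_eq_mul,
    Complex.re_sum, Complex.re_ofReal_mul, orb, re_star_dotProduct_symHop_mulVec, Finset.mul_sum]
  congr 1
  refine Finset.sum_congr rfl fun s _ => Finset.sum_congr rfl fun x _ =>
    Finset.sum_congr rfl fun σ _ => ?_
  ring

/-! ### The midpoint identity in the Gibbs state of a sector -/

/-- **The midpoint identity for the PTR trial gauge in the Gibbs state of a sector** (`L ≥ 3`): for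
the Gibbs state of ANY Hermitian block Hamiltonian `B₀` on the coordinate sector `p`,
`Re⟨(W_φ(θ)ᴴ H(θ) W_φ(θ))|_p − H^{tt'}|_p⟩ + Re⟨(W_φ(−θ)ᴴ H(−θ) W_φ(−θ))|_p − H^{tt'}|_p⟩
 = 2 [Σ_{x,i,σ} (1 − cos u_{x,i}) Re⟨B_{x,i,σ}|_p⟩ + t' Σ_{s,x,σ} (1 − cos u^d_{s,x}) Re⟨B^d_{s,x,σ}|_p⟩]`
— the bond currents cancel between `±θ`; proved as the vanishing of the Hermitian quadratic form
`W(θ)ᴴH(θ)W(θ) + W(−θ)ᴴH(−θ)W(−θ) − 2H^{tt'} − M_φ(θ)` and positivity of the Gibbs state on `±` it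
(PTR98 §IV: "the energy term leads to an expression identical to that obtained at `T = 0` with
thermal expectation values instead"). [cite: ParamekantiTrivediRanderia1998, §IV eqs. (heat), (trial-rho)] -/
theorem re_gibbsState_conj_trialGauge_add_neg (hL : 3 ≤ L) (t' U θ β : ℝ) (φ : Site 2 L → ℝ)
    (p : Finset (Orb (FermionTorus 2 L)) → Prop) [Fintype {a // p a}] [DecidableEq {a // p a}]
    {B₀ : Matrix {a // p a} {a // p a} ℂ} (hB₀ : B₀.IsHermitian) :
    (gibbsState β B₀ (((phaseGauge fun u : FermionTorus 2 L =>
            twistGauge L θ u.toTorusSite * Circle.exp (-(θ / L * φ u.toTorusSite)))ᴴ *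
          hubbardTorusTT'Flux L t' U θ *
          phaseGauge (fun u : FermionTorus 2 L =>
            twistGauge L θ u.toTorusSite * Circle.exp (-(θ / L * φ u.toTorusSite)))).toBlock p p -
          (hubbardTorusTT' L 1 t' U).toBlock p p)).re +
        (gibbsState β B₀ (((phaseGauge fun u : FermionTorus 2 L =>
            twistGauge L (-θ) u.toTorusSite * Circle.exp (-(-θ / L * φ u.toTorusSite)))ᴴ *
          hubbardTorusTT'Flux L t' U (-θ) *
          phaseGauge (fun u : FermionTorus 2 L =>
            twistGauge L (-θ) u.toTorusSite * Circle.exp (-(-θ / L * φ u.toTorusSite)))).toBlock p p -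
          (hubbardTorusTT' L 1 t' U).toBlock p p)).re =
      2 * ((∑ x : Site 2 L, ∑ i : Fin 2, ∑ σ : Fin 2,
          (1 - Real.cos (θ / L * ((![1, 0] : Fin 2 → ℝ) i + φ (x.shift i) - φ x))) *
            (gibbsState β B₀ ((creation (orb (FermionTorus.ofTorusSite (Site.shift x i)) σ) *
                annihilation (orb (FermionTorus.ofTorusSite x) σ) +
              creation (orb (FermionTorus.ofTorusSite x) σ) *
                annihilation (orb (FermionTorus.ofTorusSite (Site.shift x i)) σ)).toBlock p p)).re) +
        t' * ∑ s : Fin 2, ∑ x : Site 2 L, ∑ σ : Fin 2,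
          (1 - Real.cos (θ / L * (1 + φ (x + torusDiagJump L s) - φ x))) *
            (gibbsState β B₀ ((creation (orb (FermionTorus.ofTorusSite (x + torusDiagJump L s)) σ) *
                annihilation (orb (FermionTorus.ofTorusSite x) σ) +
              creation (orb (FermionTorus.ofTorusSite x) σ) *
                annihilation (orb (FermionTorus.ofTorusSite (x + torusDiagJump L s)) σ)).toBlock p p)).re) := by
  set Gp := (phaseGauge fun u : FermionTorus 2 L =>
      twistGauge L θ u.toTorusSite * Circle.exp (-(θ / L * φ u.toTorusSite)))ᴴ *
    hubbardTorusTT'Flux L t' U θ *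
    phaseGauge (fun u : FermionTorus 2 L =>
      twistGauge L θ u.toTorusSite * Circle.exp (-(θ / L * φ u.toTorusSite))) with hGp
  set Gm := (phaseGauge fun u : FermionTorus 2 L =>
      twistGauge L (-θ) u.toTorusSite * Circle.exp (-(-θ / L * φ u.toTorusSite)))ᴴ *
    hubbardTorusTT'Flux L t' U (-θ) *
    phaseGauge (fun u : FermionTorus 2 L =>
      twistGauge L (-θ) u.toTorusSite * Circle.exp (-(-θ / L * φ u.toTorusSite))) with hGm
  set H := hubbardTorusTT' L 1 t' U with hH
  set M := ((∑ x : Site 2 L, ∑ i : Fin 2, ∑ σ : Fin 2,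
      ((2 * (1 - Real.cos (θ / L * ((![1, 0] : Fin 2 → ℝ) i + φ (x.shift i) - φ x))) : ℝ) : ℂ) •
        (creation (orb (FermionTorus.ofTorusSite (Site.shift x i)) σ) *
            annihilation (orb (FermionTorus.ofTorusSite x) σ) +
          creation (orb (FermionTorus.ofTorusSite x) σ) *
            annihilation (orb (FermionTorus.ofTorusSite (Site.shift x i)) σ))) +
    ∑ s : Fin 2, ∑ x : Site 2 L, ∑ σ : Fin 2,
      ((t' * (2 * (1 - Real.cos (θ / L * (1 + φ (x + torusDiagJump L s) - φ x)))) : ℝ) : ℂ) •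
        (creation (orb (FermionTorus.ofTorusSite (x + torusDiagJump L s)) σ) *
            annihilation (orb (FermionTorus.ofTorusSite x) σ) +
          creation (orb (FermionTorus.ofTorusSite x) σ) *
            annihilation (orb (FermionTorus.ofTorusSite (x + torusDiagJump L s)) σ))) with hM
  set D := Gp + Gm - ((2 : ℝ) : ℂ) • H - M with hD
  have hMh : M.IsHermitian := by
    rw [hM]
    refine IsHermitian.add (isHermitian_sum₃ _ fun x i σ => isHermitian_ofReal_smul ?_ _)
      (isHermitian_sum₃ _ fun s x σ => isHermitian_ofReal_smul ?_ _) <;>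
    · show _ᴴ = _
      rw [conjTranspose_add, conjTranspose_creation_mul_annihilation,
        conjTranspose_creation_mul_annihilation, add_comm]
  have hDh : D.IsHermitian :=
    (((isHermitian_conj_hubbardTorusTT'Flux _ t' U θ).add
      (isHermitian_conj_hubbardTorusTT'Flux _ t' U (-θ))).sub
      (isHermitian_ofReal_smul (hubbardTorusTT'_isHermitian L 1 t' U) _)).sub hMh
  have hq : ∀ v : Fock (Orb (FermionTorus 2 L)), star v ⬝ᵥ (D *ᵥ v) = 0 := by
    intro v
    have hre : (star v ⬝ᵥ (D *ᵥ v)).re = 0 := by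
      have hp' := re_star_dotProduct_conj_trialGauge_mulVec hL t' U θ φ v
      have hm' := re_star_dotProduct_conj_trialGauge_mulVec hL t' U (-θ) φ v
      have hM' := re_star_dotProduct_bondWeightOp_mulVec (L := L) t' θ φ v
      rw [← hGp, ← hH] at hp'
      rw [← hGm, ← hH] at hm'
      rw [← hM] at hM'
      simp only [neg_div, neg_mul, Real.cos_neg, Real.sin_neg, mul_neg] at hm'
      have e1 := sum3_add_sum3_neg
        (fun x i σ => 2 * (1 - Real.cos (θ / L * ((![1, 0] : Fin 2 → ℝ) i + φ (x.shift i) - φ x))))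
        (fun x i σ => (star v ⬝ᵥ ((creation (orb (FermionTorus.ofTorusSite (Site.shift x i)) σ) *
                annihilation (orb (FermionTorus.ofTorusSite x) σ)) *ᵥ v)).re)
        (fun x i σ => 2 * Real.sin (θ / L * ((![1, 0] : Fin 2 → ℝ) i + φ (x.shift i) - φ x)) *
          (star v ⬝ᵥ ((creation (orb (FermionTorus.ofTorusSite (Site.shift x i)) σ) *
                annihilation (orb (FermionTorus.ofTorusSite x) σ)) *ᵥ v)).im)
      have e2 := sum3_add_sum3_neg
        (fun s x σ => 2 * (1 - Real.cos (θ / L * (1 + φ (x + torusDiagJump L s) - φ x))))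
        (fun s x σ => (star v ⬝ᵥ ((creation (orb (FermionTorus.ofTorusSite (x + torusDiagJump L s)) σ) *
                annihilation (orb (FermionTorus.ofTorusSite x) σ)) *ᵥ v)).re)
        (fun s x σ => 2 * Real.sin (θ / L * (1 + φ (x + torusDiagJump L s) - φ x)) *
          (star v ⬝ᵥ ((creation (orb (FermionTorus.ofTorusSite (x + torusDiagJump L s)) σ) *
                annihilation (orb (FermionTorus.ofTorusSite x) σ)) *ᵥ v)).im)
      have e2' := congrArg (fun z : ℝ => t' * z) e2
      simp only [mul_add] at e2'
      rw [hD, sub_mulVec, sub_mulVec, add_mulVec, dotProduct_sub, dotProduct_sub, dotProduct_add,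
        Complex.sub_re, Complex.sub_re, Complex.add_re, smul_mulVec, dotProduct_smul, smul_eq_mul,
        Complex.re_ofReal_mul, hp', hm', hM']
      linarith
    have him : (star v ⬝ᵥ (D *ᵥ v)).im = 0 := by
      simpa using hDh.im_star_dotProduct_mulVec_self v
    exact Complex.ext (by simpa using hre) (by simpa using him)
  have hpos : D.PosSemidef := PosSemidef.of_dotProduct_mulVec_nonneg hDh fun v => by rw [hq v]
  have hneg : (-D).PosSemidef :=
    PosSemidef.of_dotProduct_mulVec_nonneg hDh.neg fun v => by
      rw [neg_mulVec, dotProduct_neg, hq v, neg_zero]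
  have h1 : 0 ≤ gibbsState β B₀ (D.toBlock p p) :=
    gibbsState_nonneg_of_posSemidef β hB₀ (hpos.submatrix Subtype.val)
  have h2 : 0 ≤ gibbsState β B₀ ((-D).toBlock p p) :=
    gibbsState_nonneg_of_posSemidef β hB₀ (hneg.submatrix Subtype.val)
  have hnegblock : (-D).toBlock p p = -D.toBlock p p := rfl
  rw [hnegblock, map_neg, neg_nonneg] at h2
  have hzero : gibbsState β B₀ (D.toBlock p p) = 0 := le_antisymm h2 h1
  have hsplit : Gp.toBlock p p - H.toBlock p p + (Gm.toBlock p p - H.toBlock p p) =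
      D.toBlock p p + M.toBlock p p := by
    ext a b
    simp only [hD, toBlock_apply, Matrix.add_apply, Matrix.sub_apply, Matrix.smul_apply, smul_eq_mul]
    push_cast
    ring
  have hMblock : M.toBlock p p =
      (∑ x : Site 2 L, ∑ i : Fin 2, ∑ σ : Fin 2,
        ((2 * (1 - Real.cos (θ / L * ((![1, 0] : Fin 2 → ℝ) i + φ (x.shift i) - φ x))) : ℝ) : ℂ) •
          (creation (orb (FermionTorus.ofTorusSite (Site.shift x i)) σ) *
                annihilation (orb (FermionTorus.ofTorusSite x) σ) +
              creation (orb (FermionTorus.ofTorusSite x) σ) *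
                annihilation (orb (FermionTorus.ofTorusSite (Site.shift x i)) σ)).toBlock p p) +
        ∑ s : Fin 2, ∑ x : Site 2 L, ∑ σ : Fin 2,
          ((t' * (2 * (1 - Real.cos (θ / L * (1 + φ (x + torusDiagJump L s) - φ x)))) : ℝ) : ℂ) •
            (creation (orb (FermionTorus.ofTorusSite (x + torusDiagJump L s)) σ) *
                annihilation (orb (FermionTorus.ofTorusSite x) σ) +
              creation (orb (FermionTorus.ofTorusSite x) σ) *
                annihilation (orb (FermionTorus.ofTorusSite (x + torusDiagJump L s)) σ)).toBlock p p := by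
    ext a b
    simp only [hM, toBlock_apply, Matrix.add_apply, Matrix.sum_apply, Matrix.smul_apply, smul_eq_mul]
  rw [← Complex.add_re, ← map_add, hsplit, map_add, hzero, zero_add, hMblock]
  simp only [map_add, map_sum, map_smul, smul_eq_mul, Complex.add_re, Complex.re_sum,
    Complex.re_ofReal_mul, mul_add, Finset.mul_sum]
  congr 1
  · refine Finset.sum_congr rfl fun x _ => Finset.sum_congr rfl fun i _ =>
      Finset.sum_congr rfl fun σ _ => ?_
    ring
  · refine Finset.sum_congr rfl fun s _ => Finset.sum_congr rfl fun x _ =>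
      Finset.sum_congr rfl fun σ _ => ?_
    ring

/-! ### The thermal gauge-function bound -/

/-- **The gauge-function bound on the flux cost of the sector free energy** (`L ≥ 3`; every
`t', U, β`, every coordinate sector `p` and EVERY `φ : (ℤ/L)² → ℝ`; Paramekanti–Trivedi–Randeria
1998 §IV at finite temperature, eqs. (heat), (var-bd) with thermal expectation values, here in
exact `1 − cos` form and via Peierls–Bogoliubov instead of the trial density matrix (trial-rho)):
`log Z_β(H^{tt'}|_p) − β [Σ_{x,i,σ} (1 − cos u_{x,i}) Re⟨B_{x,i,σ}⟩_{β,p}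
 + t' Σ_{s,x,σ} (1 − cos u^d_{s,x}) Re⟨B^d_{s,x,σ}⟩_{β,p}] ≤ log Z_β(H^{tt'}(θ)|_p)`,
`u_{x,i} = (θ/L)(δ_{i,0} + φ(x+eᵢ) − φ(x))`, `u^d_{s,x} = (θ/L)(1 + φ(x+j_s) − φ(x))`,
`B = c†_{x+eᵢ,σ} c_{x,σ} + h.c.` — i.e. for `β > 0`, `F_p(θ) − F_p(0) ≤ Σ_b t_b (1 − cos u_b) Re⟨B_b⟩_{β,p}`;
`φ = 0` is the thermal f-sum bound `log_partitionFn_toBlock_hubbardTorusTT'Flux_ge`.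
[cite: ParamekantiTrivediRanderia1998, §IV eqs. (heat)–(var-bd) and (trial-rho)] -/
theorem log_partitionFn_toBlock_hubbardTorusTT'Flux_ge_trialGauge (hL : 3 ≤ L) (t' U θ β : ℝ)
    (φ : Site 2 L → ℝ) (p : Finset (Orb (FermionTorus 2 L)) → Prop) [Fintype {a // p a}]
    [DecidableEq {a // p a}] :
    Real.log (partitionFn β ((hubbardTorusTT' L 1 t' U).toBlock p p)).re -
        β * ((∑ x : Site 2 L, ∑ i : Fin 2, ∑ σ : Fin 2,
            (1 - Real.cos (θ / L * ((![1, 0] : Fin 2 → ℝ) i + φ (x.shift i) - φ x))) *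
              (gibbsState β ((hubbardTorusTT' L 1 t' U).toBlock p p)
                ((creation (orb (FermionTorus.ofTorusSite (Site.shift x i)) σ) *
                annihilation (orb (FermionTorus.ofTorusSite x) σ) +
              creation (orb (FermionTorus.ofTorusSite x) σ) *
                annihilation (orb (FermionTorus.ofTorusSite (Site.shift x i)) σ)).toBlock p p)).re) +
          t' * ∑ s : Fin 2, ∑ x : Site 2 L, ∑ σ : Fin 2,
            (1 - Real.cos (θ / L * (1 + φ (x + torusDiagJump L s) - φ x))) *
              (gibbsState β ((hubbardTorusTT' L 1 t' U).toBlock p p)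
                ((creation (orb (FermionTorus.ofTorusSite (x + torusDiagJump L s)) σ) *
                annihilation (orb (FermionTorus.ofTorusSite x) σ) +
              creation (orb (FermionTorus.ofTorusSite x) σ) *
                annihilation (orb (FermionTorus.ofTorusSite (x + torusDiagJump L s)) σ)).toBlock p p)).re) ≤
      Real.log (partitionFn β ((hubbardTorusTT'Flux L t' U θ).toBlock p p)).re := by
  rcases isEmpty_or_nonempty {a // p a} with hp | hp
  · simp [partitionFn, Matrix.trace, gibbsState_apply]
  set B₀ := (hubbardTorusTT' L 1 t' U).toBlock p p with hB₀def
  have hB₀ : B₀.IsHermitian := (hubbardTorusTT'_isHermitian L 1 t' U).submatrix _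
  have hWp : (((phaseGauge fun u : FermionTorus 2 L =>
        twistGauge L θ u.toTorusSite * Circle.exp (-(θ / L * φ u.toTorusSite)))ᴴ *
      hubbardTorusTT'Flux L t' U θ *
      phaseGauge (fun u : FermionTorus 2 L =>
        twistGauge L θ u.toTorusSite * Circle.exp (-(θ / L * φ u.toTorusSite)))).toBlock p p - B₀).IsHermitian :=
    ((isHermitian_conj_hubbardTorusTT'Flux _ t' U θ).submatrix _).sub hB₀
  have hWm : (((phaseGauge fun u : FermionTorus 2 L =>
        twistGauge L (-θ) u.toTorusSite * Circle.exp (-(-θ / L * φ u.toTorusSite)))ᴴ *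
      hubbardTorusTT'Flux L t' U (-θ) *
      phaseGauge (fun u : FermionTorus 2 L =>
        twistGauge L (-θ) u.toTorusSite * Circle.exp (-(-θ / L * φ u.toTorusSite)))).toBlock p p - B₀).IsHermitian :=
    ((isHermitian_conj_hubbardTorusTT'Flux _ t' U (-θ)).submatrix _).sub hB₀
  -- Peierls–Bogoliubov at the untwisted block, for `+θ` and `-θ`, in the trial gauge
  have hPB1 := log_partitionFn_sub_le_log_partitionFn_add hB₀ hWp β
  have hPB2 := log_partitionFn_sub_le_log_partitionFn_add hB₀ hWm β
  rw [add_sub_cancel, partitionFn_toBlock_conj_hubbardTorusTT'Flux] at hPB1 hPB2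
  -- time reversal
  rw [re_partitionFn_toBlock_hubbardTorusTT'Flux_neg] at hPB2
  -- the two first-order terms add up to the bond-weight sum
  have hsum := re_gibbsState_conj_trialGauge_add_neg hL t' U θ β φ p hB₀
  rw [← hB₀def] at hsum
  have hkey := congrArg (fun z : ℝ => β * z) hsum
  simp only [mul_add] at hkey
  linarith

end Literature.MathematicalPhysics.QuantumLattice

end
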